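import Mathlib.Algebra.Star.Basic
import Mathlib.Algebra.Group.Hom.Defs
import Mathlib.GroupTheory.Index
import Mathlib.GroupTheory.OrderOfElement
import Mathlib.NumberTheory.Multiplicity
import Mathlib.NumberTheory.Padics.PadicVal.Basic
import Mathlib.Algebra.Order.Ring.GeomSum
import Mathlib.Data.ZMod.Units
import Mathlib.Data.ZMod.QuotientGroup
import Mathlib.Data.Nat.Totient
import Mathlib.Tactic.IntervalCases
import Mathlib.Tactic.Linarith
import Mathlib.Tactic.Ring
import HarnessLib

/-!
# Triviality of the Gauss-period constants: the algebraic skeleton of THEOREM N₂ (WEIL-2 gen 40, N2-G40, fact-free)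

research route, not a corollary; conditional on HC_CM plus one named minimal statement.

Cell `pub-hodge-ring2-ab-*` (ALL ABELIAN VARIETIES), seat WEIL-2 gen 40, account
`run/shared/lean/pub/pub-hodge-ring2/pub-hodge-ring2-ab-weil-2/N2-G40.md`.

Informal setting (TWOPRIMARY-G38 §1, IMAGE-G39 §11–§12, N2-G40).  For a level `f = 2^k p^a`, `L = ℚ(ζ_f)`, `h ∈ (ℤ/f)^×`
with `L_h = L^{σ_h}` imaginary, the level character of `G = ℤ/f ⋊ ker χ_K` is a closed formula in cyclotomic-unit norms and
discriminants times ONE arithmetic constant per `h`, the Gauss-period class `g_h = [N_{L_h⁺/ℚ}(π π̄)] ∈ ℚ_{>0}/Nm K^×` of a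
resolvent `π` (`σ_h π = u π`, `u` a `2`-power root of unity).  THEOREM N₂ computes every such constant: it is trivial unless
`h ≡ 3 (mod 4)`, `h ≢ −1 (mod 2^k)` and `p ≡ 5 (mod 8)`, where it is the class `c` with Hilbert symbols `−1` at `2` and `p`.
The proof has four finite ingredients, proved here in general form:

* (§1, transport) if `σ π = u π` and `g` commutes with `σ`, then `g π` is a resolvent for `g u`; the norm element `π π̄` is
  transported accordingly; and a character with values in a group of exponent two takes the same value on `u` and on every
  ODD power `u^a = g u` — so the refined Gauss-period class is `Gal(L_h⁺/ℚ)`-invariant and its local norm symbols are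
  constant along the places of `L_h⁺` above `p`: `(g_h)_p = s_p^{n_p}`;
* (§2, index parity) a subgroup contained in a subgroup of index two has even index — the number `n_p` of places above `p`
  is even when `h ≡ 7 (mod 8)` and `p ≡ 1 (mod 8)` (`⟨h, −1, p⟩ ⊂ {±1}·Γ₂²`);
* (§3, Hensel at 2) an integer `≡ 1 (mod 8)` is an odd square modulo every `2^k` — `p ≡ 1 (mod 8)` is a square in `(ℤ/2^k)^×`;
* (§4, the `2`-adic valuation of the Frobenius exponent) for `p ≡ 5 (mod 8)` and `n = 2^{k−2}`:
  `v₂(p^n − 1) = k` and `v₂(1 + p + ⋯ + p^{n−1}) = k − 2`, so that `N_{ℚ_p(ζ_{2^k})/ℚ_p}(ζ_{2^k}) = ζ_{2^k}^{1+p+⋯+p^{n−1}}` is a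
  PRIMITIVE fourth root of unity;
* (§5) in a finite commutative group of order `4·odd` an element of order `4` is not a square — a primitive fourth root of
  unity is a quadratic NON-residue modulo `p ≡ 5 (mod 8)`, which is the sign `s_p = −1` of THEOREM N₂ (iv).

0 sorry, no `def`, no named fact; `HC_CM` does not occur.
-/

namespace Summit.HodgeConjecture.Ring2AbelianAll.GaussPeriodTriviality

section transport

variable {R : Type*} [CommRing R]

/-- **Galois transport of resolvents.**  If `σ π = u π` and the ring endomorphism `g` commutes with `σ`, then `g π` is a
resolvent for the eigenvalue `g u` (for `u = ζ_{2^r}` and `g ∈ Gal(ℚ(ζ_f)/ℚ)`: `g u = u^{g̃}` with `g̃` odd).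
[locator N2-G40 §1 Step 0 (ε)]  research route, not a corollary; conditional on HC_CM plus one named minimal statement. -/
theorem resolvent_transport (σ g : R →+* R) (hcomm : ∀ x, σ (g x) = g (σ x)) (u π : R) (hπ : σ π = u * π) :
    σ (g π) = g u * g π := by
  rw [hcomm, hπ, map_mul]

/-- **Transport of the norm element**: `g(π π̄) = (g π)(g π)‾` when `g` commutes with the involution (every element of the
abelian group `Gal(ℚ(ζ_f)/ℚ)` commutes with complex conjugation).  [locator N2-G40 §1 Step 0 (ε)]
research route, not a corollary; conditional on HC_CM plus one named minimal statement. -/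
theorem normElement_transport [StarRing R] (g : R →+* R) (hg : ∀ x, g (star x) = star (g x)) (π : R) :
    g (π * star π) = g π * star (g π) := by
  rw [map_mul, hg]

/-- **A character of a group of exponent two agrees on `u` and on every odd power of `u`.**  With the two transport lemmas:
the refined Gauss-period class `𝔤_h(u) ∈ (L_h⁺)^×/N(L_h^×)` satisfies `g_* 𝔤_h(u) = 𝔤_h(g u) = 𝔤_h(u^{g̃}) = 𝔤_h(u)` for every
`g ∈ Gal(L_h⁺/ℚ)` — it is Galois-INVARIANT, hence its local norm symbols are constant on the places above any rational
prime.  [locator N2-G40 §1 Step 0 (ε), Step 1]  research route, not a corollary; conditional on HC_CM plus one named minimal statement. -/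
theorem map_pow_eq_self_of_odd {A V : Type*} [CommGroup A] [CommGroup V] (φ : A →* V) (hV : ∀ v : V, v * v = 1)
    (a : A) {n : ℕ} (hn : Odd n) : φ (a ^ n) = φ a := by
  obtain ⟨m, rfl⟩ := hn
  have h2 : φ a ^ 2 = 1 := by rw [sq]; exact hV _
  rw [map_pow, pow_succ, pow_mul, h2, one_pow, one_mul]

end transport

section indexparity

/-- **Index parity.**  A subgroup contained in a subgroup of index `2` has even index.  Used with `G = (ℤ/2^k)^×`,
`K = {x : x ≡ ±1 (mod 8)}` (index `2` for `k ≥ 3`) and `H = ⟨h̃, −1, p̃⟩` for `h̃ ≡ 7 (mod 8)`, `p ≡ 1 (mod 8)`: the number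
`n_p = [G : H]` of places of `L_h⁺` above `p` is EVEN, so `(g_h)_p = s_p^{n_p} = 1`.  [locator N2-G40 §1 Step 3, case h̃ ≡ 7 (8)]
research route, not a corollary; conditional on HC_CM plus one named minimal statement. -/
theorem two_dvd_index_of_le_of_index_eq_two {G : Type*} [Group G] (H K : Subgroup G) (hHK : H ≤ K)
    (hK : K.index = 2) : 2 ∣ H.index := by
  rw [← Subgroup.relIndex_mul_index hHK, hK]
  exact dvd_mul_left 2 _

end indexparity

section hensel

/-- **Odd squares are `1 (mod 8)`** (the quadratic characters of `(ℤ/2^k)^×` factor through `(ℤ/8)^×`).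
[locator N2-G40 §1 Step 3]  research route, not a corollary; conditional on HC_CM plus one named minimal statement. -/
theorem eight_dvd_sq_sub_one_of_odd {x : ℤ} (hx : Odd x) : (8 : ℤ) ∣ x ^ 2 - 1 :=
  Int.eight_dvd_sq_sub_one_of_odd hx

/-- **Hensel's lemma at `2` for squares.**  An integer `y ≡ 1 (mod 8)` is congruent to an ODD square modulo `2^(j+3)` for
every `j`; in particular a prime `p ≡ 1 (mod 8)` is a square in `(ℤ/2^k)^×` for every `k ≥ 3` — the ingredient
`p̃ ∈ Γ₂²` of THEOREM N₂ (case `h̃ ≡ 7 (mod 8)`).  Proof: if `x² − y = 2^(j+3) t` with `t` odd, replace `x` by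
`x + 2^(j+2)`.  [locator N2-G40 §1 Step 3]  research route, not a corollary; conditional on HC_CM plus one named minimal statement. -/
theorem exists_odd_sq_sub_dvd_two_pow (y : ℤ) (hy : (8 : ℤ) ∣ y - 1) (j : ℕ) :
    ∃ x : ℤ, Odd x ∧ (2 : ℤ) ^ (j + 3) ∣ x ^ 2 - y := by
  induction j with
  | zero =>
    refine ⟨1, odd_one, ?_⟩
    have : (1 : ℤ) ^ 2 - y = -(y - 1) := by ring
    rw [this, dvd_neg]
    simpa using hy
  | succ j ih =>
    obtain ⟨x, hxodd, t, ht⟩ := ih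
    rcases Int.even_or_odd t with ⟨s, hs⟩ | ⟨s, hs⟩
    · -- t even: x already works
      refine ⟨x, hxodd, s, ?_⟩
      rw [ht, hs]; ring
    · -- t odd: x' = x + 2^(j+2)
      obtain ⟨w, hw⟩ := hxodd
      refine ⟨x + 2 ^ (j + 2), ?_, ?_⟩
      · exact ⟨w + 2 ^ (j + 1), by rw [hw]; ring⟩
      · -- (x + 2^(j+2))^2 - y = (x^2 - y) + 2^(j+3) x + 2^(2j+4) = 2^(j+3) (t + x) + 2^(j+4) 2^j
        have key : (x + 2 ^ (j + 2)) ^ 2 - y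
            = 2 ^ (j + 1 + 3) * ((s + w + 1) + 2 ^ j) := by
          have e1 : (x + 2 ^ (j + 2)) ^ 2 - y = (x ^ 2 - y) + 2 ^ (j + 3) * x + 2 ^ (j + 2) * 2 ^ (j + 2) := by ring
          rw [e1, ht, hs, hw]
          ring
        exact ⟨(s + w + 1) + 2 ^ j, key⟩

end hensel

section valuation

/-- `v₂(m) = 1` for `m ≡ 2 (mod 4)`.  research route, not a corollary; conditional on HC_CM plus one named minimal statement. -/
theorem padicValNat_two_eq_one_of_mod_four {m : ℕ} (hm : m % 4 = 2) : padicValNat 2 m = 1 := by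
  have h2 : m = 2 * (m / 2) := by omega
  have hodd : ¬ 2 ∣ m / 2 := by omega
  have hne : m / 2 ≠ 0 := by omega
  rw [h2, padicValNat.mul (by norm_num) hne, padicValNat.self (by norm_num),
    padicValNat.eq_zero_of_not_dvd hodd]

/-- `v₂(m) = 2` for `m ≡ 4 (mod 8)`.  research route, not a corollary; conditional on HC_CM plus one named minimal statement. -/
theorem padicValNat_two_eq_two_of_mod_eight {m : ℕ} (hm : m % 8 = 4) : padicValNat 2 m = 2 := by
  have h4 : m = 2 ^ 2 * (m / 4) := by omega
  have hodd : ¬ 2 ∣ m / 4 := by omega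
  have hne : m / 4 ≠ 0 := by omega
  rw [h4, padicValNat.mul (by norm_num) hne, padicValNat.prime_pow, padicValNat.eq_zero_of_not_dvd hodd]

/-- **Lifting the exponent for `p ≡ 5 (mod 8)`**: `v₂(p^{2^{k−2}} − 1) = k` for `k ≥ 3` (`v₂(p − 1) = 2`, `v₂(p + 1) = 1`).
This is the order computation `|H¹|`-side of LEMMA A and, with the next lemma, the heart of THEOREM N₂ (iv) for `p ≡ 5 (mod 8)`.
[locator N2-G40 §2 Step (4)]  research route, not a corollary; conditional on HC_CM plus one named minimal statement. -/
theorem padicValNat_two_pow_two_pow_sub_one {p k : ℕ} (hp : p % 8 = 5) (hk : 3 ≤ k) :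
    padicValNat 2 (p ^ 2 ^ (k - 2) - 1) = k := by
  have h1p : 1 < p := by omega
  have hodd : ¬ 2 ∣ p := by omega
  have hn : 2 ^ (k - 2) ≠ 0 := by positivity
  have heven : Even (2 ^ (k - 2)) := by
    obtain ⟨j, hj⟩ : ∃ j, k - 2 = j + 1 := ⟨k - 3, by omega⟩
    rw [hj, pow_succ]
    exact ⟨2 ^ j, by ring⟩
  have H := padicValNat.pow_two_sub_one h1p hodd hn heven
  rw [padicValNat_two_eq_one_of_mod_four (by omega : (p + 1) % 4 = 2),
    padicValNat_two_eq_two_of_mod_eight (by omega : (p - 1) % 8 = 4),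
    padicValNat.prime_pow] at H
  omega

/-- **The Frobenius exponent has `2`-adic valuation exactly `k − 2`.**  For `p ≡ 5 (mod 8)`, `k ≥ 3`, `n = 2^{k−2}`
(the order of `p` in `(ℤ/2^k)^×`): `v₂(1 + p + ⋯ + p^{n−1}) = k − 2`.  Consequently the norm `ζ_{2^k}^{1+p+⋯+p^{n−1}}` of
`ζ_{2^k}` from `ℚ_p(ζ_{2^k})` to `ℚ_p` is a PRIMITIVE FOURTH root of unity, and the local symbol of THEOREM N₂ (iv) at the
place above `p` is its Legendre symbol, `−1`.  [locator N2-G40 §2 Step (4)]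
research route, not a corollary; conditional on HC_CM plus one named minimal statement. -/
theorem padicValNat_two_geom_sum {p k : ℕ} (hp : p % 8 = 5) (hk : 3 ≤ k) :
    padicValNat 2 (∑ t ∈ Finset.range (2 ^ (k - 2)), p ^ t) = k - 2 := by
  have h2p : 2 ≤ p := by omega
  rw [Nat.geomSum_eq h2p, padicValNat.div_of_dvd (Nat.sub_one_dvd_pow_sub_one p _),
    padicValNat_two_pow_two_pow_sub_one hp hk, padicValNat_two_eq_two_of_mod_eight (by omega : (p - 1) % 8 = 4)]

end valuation

section fourthroot

/-- **An element of order `4` in a finite commutative group of order `4·m`, `m` odd, is not a square.**  Applied to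
`𝔽_p^×` with `p ≡ 5 (mod 8)`: a primitive fourth root of unity is a quadratic NON-residue, `(ζ₄/p) = −1` — the sign
`s_p = −1` that makes the residual Gauss-period constants at `p ≡ 5 (mod 8)` NON-trivial (THEOREM N₂ (iv)).
[locator N2-G40 §2 Step (4)]  research route, not a corollary; conditional on HC_CM plus one named minimal statement. -/
theorem not_exists_sq_eq_of_orderOf_eq_four {G : Type*} [CommGroup G] [Fintype G] {m : ℕ} (hm : Odd m)
    (hG : Fintype.card G = 4 * m) (x : G) (hx : orderOf x = 4) : ¬ ∃ y : G, y ^ 2 = x := by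
  rintro ⟨y, rfl⟩
  have hdiv : orderOf y ∣ 4 * m := hG ▸ orderOf_dvd_card
  have hpow : orderOf (y ^ 2) = orderOf y / Nat.gcd (orderOf y) 2 := orderOf_pow' y two_ne_zero
  rw [hx] at hpow
  have hg : Nat.gcd (orderOf y) 2 ∣ 2 := Nat.gcd_dvd_right _ _
  rcases (Nat.dvd_prime Nat.prime_two).mp hg with h1 | h2
  · -- gcd = 1: orderOf y = 4 but then gcd = 2
    rw [h1, Nat.div_one] at hpow
    have h' : Nat.gcd (orderOf y) 2 = 2 := by rw [← hpow]; decide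
    omega
  · -- gcd = 2: orderOf y = 8 divides 4m, m odd: contradiction
    rw [h2] at hpow
    have h8 : orderOf y = 8 ∨ orderOf y = 9 := by omega
    have heven : 2 ∣ orderOf y := by rw [← h2]; exact Nat.gcd_dvd_left _ _
    rcases h8 with h8 | h9
    · rw [h8] at hdiv
      obtain ⟨c, hc⟩ := hdiv
      obtain ⟨r, hr⟩ := hm
      omega
    · omega

end fourthroot

end Summit.HodgeConjecture.Ring2AbelianAll.GaussPeriodTriviality

/-! ## Appendix (gen 40, v2): the `Γ₂ = (ℤ/2^k)^×` combinatorics of THEOREM N₂, kernel-checked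

For a level `f = 2^k p^a` the places of `L_h⁺` above `p` are indexed by `Γ₂/⟨h̃, −1, p̃⟩` and they split in `L_h/L_h⁺` iff
`−1 ∉ ⟨h̃, p̃⟩` (N2-G40 §1.3).  The three cases of THEOREM N₂ for `p ≡ 1 (mod 8)` are decided by reduction modulo `8` (resp. `4`):
generators `≡ 1 (mod 4)` or `≡ 1, 3 (mod 8)` never produce `−1`; generators `≡ ±1 (mod 8)` generate a subgroup of EVEN index.  We prove
these for the unit group of `ZMod m` for every modulus `m` divisible by `8` (resp. `4`), via the reduction maps `ZMod.unitsMap`. -/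

namespace Summit.HodgeConjecture.Ring2AbelianAll.GaussPeriodTriviality

open Subgroup

section twopowerunits

/-- `(ℤ/8)^×` has four elements.  research route, not a corollary; conditional on HC_CM plus one named minimal statement. -/
theorem card_units_zmod_eight : Nat.card (ZMod 8)ˣ = 4 := by
  rw [Nat.card_eq_fintype_card, ZMod.card_units_eq_totient]
  decide

/-- `−1` has order `2` in `(ℤ/8)^×`.  research route, not a corollary; conditional on HC_CM plus one named minimal statement. -/
theorem orderOf_neg_one_units_zmod_eight : orderOf (-1 : (ZMod 8)ˣ) = 2 := by
  apply orderOf_eq_prime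
  · rw [neg_one_sq]
  · decide

/-- `{±1} ⊂ (ℤ/8)^×` has index `2` (it is `Γ₂²·{±1}` read modulo `8`).  [locator N2-G40 §1.4 (b)]
research route, not a corollary; conditional on HC_CM plus one named minimal statement. -/
theorem index_zpowers_neg_one_units_zmod_eight : (zpowers (-1 : (ZMod 8)ˣ)).index = 2 := by
  have h := (zpowers (-1 : (ZMod 8)ˣ)).index_mul_card
  rw [card_units_zmod_eight, Nat.card_zpowers, orderOf_neg_one_units_zmod_eight] at h
  omega

/-- The reduction modulo `8` of a unit of `ZMod m` (`8 ∣ m`) is read off from its value modulo `8`.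
research route, not a corollary; conditional on HC_CM plus one named minimal statement. -/
theorem val_unitsMap_eight {m : ℕ} [NeZero m] (hd : 8 ∣ m) (u : (ZMod m)ˣ) :
    ((ZMod.unitsMap hd u : (ZMod 8)ˣ) : ZMod 8) = (((u : ZMod m).val % 8 : ℕ) : ZMod 8) := by
  rw [ZMod.unitsMap_val, ZMod.cast_eq_val, ZMod.natCast_mod]

/-- A unit `≡ 1 (mod 8)` reduces to `1` in `(ℤ/8)^×` (e.g. `p̃` for `p ≡ 1 (mod 8)`).
research route, not a corollary; conditional on HC_CM plus one named minimal statement. -/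
theorem unitsMap_eight_eq_one {m : ℕ} [NeZero m] (hd : 8 ∣ m) (u : (ZMod m)ˣ) (h1 : (u : ZMod m).val % 8 = 1) :
    ZMod.unitsMap hd u = 1 := by
  ext
  rw [val_unitsMap_eight, h1]
  rfl

/-- A unit `≡ 7 (mod 8)` reduces to `−1` in `(ℤ/8)^×` (e.g. `h̃ ≡ 7 (mod 8)`, or `−1` itself).
research route, not a corollary; conditional on HC_CM plus one named minimal statement. -/
theorem unitsMap_eight_eq_neg_one {m : ℕ} [NeZero m] (hd : 8 ∣ m) (u : (ZMod m)ˣ) (h7 : (u : ZMod m).val % 8 = 7) :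
    ZMod.unitsMap hd u = -1 := by
  ext
  rw [val_unitsMap_eight, h7]
  rfl

/-- **THEOREM N₂, case `h̃ ≡ 7 (mod 8)`, `p ≡ 1 (mod 8)`: the number of places above `p` is EVEN.**  In `(ℤ/m)^×` with `8 ∣ m`, a
subgroup generated by elements `≡ ±1 (mod 8)` (here `h̃`, `−1`, `p̃`) has even index: it lies in the preimage of `{±1} ⊂ (ℤ/8)^×`, which
has index `2` because the reduction map is surjective.  Hence `n_p = [Γ₂ : ⟨h̃, −1, p̃⟩]` is even and `(g_h)_p = s_p^{n_p} = 1`.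
[locator N2-G40 §1.4 (b)]  research route, not a corollary; conditional on HC_CM plus one named minimal statement. -/
theorem two_dvd_index_closure_of_val_mod_eight {m : ℕ} [NeZero m] (hd : 8 ∣ m) (S : Set (ZMod m)ˣ)
    (hS : ∀ s ∈ S, (s : ZMod m).val % 8 = 1 ∨ (s : ZMod m).val % 8 = 7) : 2 ∣ (closure S).index := by
  set f := ZMod.unitsMap hd with hf
  have hQ : ((zpowers (-1 : (ZMod 8)ˣ)).comap f).index = 2 := by
    rw [index_comap_of_surjective _ (ZMod.unitsMap_surjective hd), index_zpowers_neg_one_units_zmod_eight]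
  have hle : closure S ≤ (zpowers (-1 : (ZMod 8)ˣ)).comap f := by
    rw [closure_le]
    intro s hs
    rw [SetLike.mem_coe, mem_comap]
    rcases hS s hs with h1 | h7
    · rw [unitsMap_eight_eq_one hd s h1]; exact one_mem _
    · rw [unitsMap_eight_eq_neg_one hd s h7]; exact mem_zpowers _
  rw [← relIndex_mul_index hle, hQ]
  exact dvd_mul_left 2 _

/-- **THEOREM N₂, case `h̃ ≡ 3 (mod 8)`, `p ≡ 1, 3 (mod 8)`: the places above `p` SPLIT.**  In `(ℤ/m)^×` with `8 ∣ m`, elements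
`≡ 1` or `≡ 3 (mod 8)` never generate `−1`: they reduce into the subgroup `{1, 3} ⊂ (ℤ/8)^×` (the kernel of `χ_{−8}`), which misses
`−1 ≡ 7`.  Field-theoretically: `√−2 ∈ L_h` and `−2` is a square in `ℚ_p`.  [locator N2-G40 §1.4 (a)]
research route, not a corollary; conditional on HC_CM plus one named minimal statement. -/
theorem neg_one_not_mem_closure_of_val_mod_eight {m : ℕ} [NeZero m] (hd : 8 ∣ m) (S : Set (ZMod m)ˣ)
    (hS : ∀ s ∈ S, (s : ZMod m).val % 8 = 1 ∨ (s : ZMod m).val % 8 = 3) : (-1 : (ZMod m)ˣ) ∉ closure S := by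
  set f := ZMod.unitsMap hd with hf
  let u3 : (ZMod 8)ˣ := ZMod.unitOfCoprime 3 (by decide)
  have hu3 : orderOf u3 = 2 := by
    apply orderOf_eq_prime
    · ext; decide
    · decide
  have hle : closure S ≤ (zpowers u3).comap f := by
    rw [closure_le]
    intro s hs
    rw [SetLike.mem_coe, mem_comap]
    rcases hS s hs with h1 | h3
    · rw [unitsMap_eight_eq_one hd s h1]; exact one_mem _
    · have : f s = u3 := by
        ext; rw [hf, val_unitsMap_eight, h3]; rfl
      rw [this]; exact mem_zpowers _
  intro hmem
  have h' := hle hmem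
  have hneg : f (-1) = -1 := by
    rw [hf, ZMod.unitsMap_def, Units.map_neg, map_one]
  rw [mem_comap, hneg, mem_zpowers_iff_mem_range_orderOf, hu3] at h'
  simp only [Finset.mem_image, Finset.mem_range] at h'
  obtain ⟨i, hi, he⟩ := h'
  interval_cases i
  · exact absurd he (by decide)
  · exact absurd he (by rw [pow_one]; decide)

/-- **THEOREM N₂, Kummer case `h̃ ≡ 1 (mod 4)`, `p ≡ 1 (mod 4)`: the places above `p` SPLIT.**  In `(ℤ/m)^×` with `4 ∣ m`,
elements `≡ 1 (mod 4)` never generate `−1` (they reduce to `1` in `(ℤ/4)^×`, `−1` does not).  Field-theoretically: `i ∈ L_h` and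
`−1` is a square in `ℚ_p`.  [locator N2-G40 §1.4 (a)]  research route, not a corollary; conditional on HC_CM plus one named minimal statement. -/
theorem neg_one_not_mem_closure_of_val_mod_four {m : ℕ} [NeZero m] (hd : 4 ∣ m) (S : Set (ZMod m)ˣ)
    (hS : ∀ s ∈ S, (s : ZMod m).val % 4 = 1) : (-1 : (ZMod m)ˣ) ∉ closure S := by
  set f := ZMod.unitsMap hd with hf
  have hle : closure S ≤ (⊥ : Subgroup (ZMod 4)ˣ).comap f := by
    rw [closure_le]
    intro s hs
    rw [SetLike.mem_coe, mem_comap, mem_bot]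
    ext
    rw [hf, ZMod.unitsMap_val, ZMod.cast_eq_val, ← ZMod.natCast_mod, hS s hs]
    rfl
  intro hmem
  have h' := hle hmem
  have hneg : f (-1) = -1 := by
    rw [hf, ZMod.unitsMap_def, Units.map_neg, map_one]
  rw [mem_comap, hneg, mem_bot] at h'
  exact absurd h' (by decide)

end twopowerunits

end Summit.HodgeConjecture.Ring2AbelianAll.GaussPeriodTriviality
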